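import Literature.Topology.FourManifolds.LatticeFormsEichlerReflections
import Literature.Topology.FourManifolds.LatticeFormsEichlerTransitivity
import HarnessLib

/-!
# Reflections in `(±2)`-vectors modulo the unimodular transvections: `σ_r = ρ · σ_{e−f}` with `ρ ∈ E_U(L₁)`,
# `E(L) = E_U(L₁)`, and `σ_a σ_b ∈ E(L)` (Gritsenko–Hulek–Sankaran, *J. Algebra* 322 (2009) §3, Prop. 3.3 (ii), (iv))

Trunk T-4MAN vocabulary. Sequel of `LatticeFormsEichlerCriterion.lean` (GHS Lemma 3.2: admissible words
`UGen.eval B x y l` in the Eichler transvections `E(y, a, q)`, `E(x, a, q)`, `a ⊥ x, y` — GHS's group `E_U(L₁)` for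
`U = ⟨x, y⟩` — move every vector into `U^⊥`, `exists_uGens_ortho`), `LatticeFormsEichlerTransitivity.lean` (inverse
words `UGen.invWord`, bundled words `UGen.evalEquiv`, the Eichler criterion `exists_uGens_apply_eq`) and
`LatticeFormsEichlerReflections.lean` (reflections `σ_r = normTwoReflection r ε` in vectors of norm `2ε`, GHS's identity
(t7) `eichlerTransvection_t7`, and Prop. 3.3 (iv) as a word in KIRBY's generators `S(Q) = {A_a, A'_a, 1 ⊕ O(H)}`,
`isWordIn_wallGenerators_normTwoReflectionEquiv`). Written for lane `lit-hodgefound` (Track 2 foundations; prover seat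
`lit-hodgefound-p18`, gen 49, row g49-#1). THEOREMS ONLY — no definition, no named fact, no instance, no notation.

This file states Prop. 3.3 (ii) and (iv) IN `E_U(L₁)` PROPER, i.e. as admissible words (no `1 ⊕ O(H)` letters), for an
arbitrary symmetric integral bilinear module `(W, B)` with two orthogonal hyperbolic pairs `(x, y)`, `(x₁, y₁)`
(`TwoHyperbolicPairs`; GHS's `L = U ⊕ U₁ ⊕ L₀`, `e, f = y, x`): "`ρ ∈ E_U(L₁)`" is rendered as
"`∃ l, (∀ g ∈ l, g.IsAdmissible B x y) ∧ ρ = UGen.eval B x y l`" (pointwise).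

## Source, verbatim (held text `paper:arxiv-0810.1614`, pp. 6–7)

* §3.1: "(t5) `t(xe,a) = t(e,xa)`, `t(e,xe) = id` `∀ x ∈ ℚ^*`", "(t7) `t(f,a) t(e, (2/(a,a)) a) t(f,a) = σ_a σ_{e+(2/(a,a))f}`",
  "Moreover for any primitive isotropic `e` in `L`, `t(e,∗) : e^⊥_L → S̃O⁺(L)` is a homomorphism of groups with
  kernel `ℤe`."
* §3.3: "`E(L) := ⟨{t(e,a) | e,a ∈ L, (e,e) = (e,a) = 0, div(e) = 1}⟩`. […] `E_U(L₁) := ⟨{t(e,a), t(f,a) | a ∈ L₁}⟩`.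
  **Proposition 3.3.** Let `L = U ⊕ U₁ ⊕ L₀` […] (ii) `E(L) = E_U(L₁)`. […] (iv) For any `(−2)`-vector `r ∈ L` there
  exists `ρ ∈ E_U(L₁)` such that `σ_r = ρ·σ_{e−f}`. *Proof.* […] (ii) Let `t(u,a)` be an arbitrary unimodular
  transvection in `E(L)` with `(u,u) = 0` and `div(u) = 1`. According to (i) there exists `τ ∈ E_U(L₁)` such that
  `τ(u) = e`. By equation (t4) we obtain that `τ t(u,a) τ⁻¹ = t(τ(u), τ(a)) = t(e, τ(a))` is in `E_U(L₁)`. […]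
  (iv) There exists `τ ∈ E_U(L₁)` such that `τ(r) = a ∈ L₁`. According to equation (t7)
  `τ σ_r τ⁻¹ = σ_a = t(f,a) t(e,−a) t(f,a) σ_{e−f}` (`σ_a` and `σ_{e−f}` commute). To finish we use that
  `σ_{e−f} τ σ_{e−f} ∈ E_U(L₁)` for any `τ ∈ E_U(L₁)`. □"
* Proof of Prop. 3.4: "According to Proposition 3.3 (iv) the product `σ_a σ_b` of any two reflections with
  `(a,a) = (b,b) = −2` belongs to `E(L)`."

## Contents (all proved) and reading notes

* §1 (t5) with the tree's parameter `q = ½(a,a)`: `E(c e, a, q) = E(e, c a, c² q)` (`eichlerTransvection_smul_left`);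
  the reflection `σ_w`, `w = x + ε y` (`(w,w) = 2ε`; for `ε = −1` GHS's `σ_{e−f}`), swaps the pair up to sign
  (`σ_w x = −ε y`, `σ_w y = −ε x`) and fixes `U^⊥`; hence **"`σ_{e−f} τ σ_{e−f} ∈ E_U(L₁)`"**: the `σ_w`-conjugate of
  an admissible generator (resp. word) is an admissible generator (resp. word): `E(y,a,q) ↦ E(x,−εa,q)`,
  `E(x,a,q) ↦ E(y,−εa,q)` (`UGen.exists_conj_normTwoReflection`, `UGen.exists_eval_conj_normTwoReflection`).
* §2 **Prop. 3.3 (iv) for every `(2ε)`-vector `r`** (`ε = ±1`; no evenness, primitivity or divisor hypothesis is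
  used — only Lemma 3.2): `σ_r = ρ ∘ σ_w` with `ρ` an admissible word (`exists_uGens_normTwoReflection_eq`), also
  `σ_r = σ_w ∘ ρ'` (`exists_uGens_normTwoReflection_eq'`) and the bundled form
  `normTwoReflectionEquiv r = σ_w.trans (UGen.evalEquiv l)` (`exists_normTwoReflectionEquiv_eq_trans_evalEquiv`). The word
  is the printed one: `ρ = τ⁻¹ · (t(y,a) t(x,εa) t(y,a)) · (σ_w τ σ_w)`.
* §3 **"the product `σ_a σ_b` of any two reflections with `(a,a) = (b,b) = −2` belongs to `E(L)`"**, for either sign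
  `(a,a) = (b,b) = 2ε` (`exists_uGens_normTwoReflection_normTwoReflection_eq`), and by induction: a word of `(2ε)`-reflections
  of even length is an admissible word, one of odd length is an admissible word times `σ_w`
  (`exists_uGens_wordProd_eq_of_even`, `exists_uGens_wordProd_eq_of_odd`).
* §4 **Prop. 3.3 (ii) `E(L) = E_U(L₁)`** for the generators: every `t(u,a)` with `u` isotropic having a dual vector
  `z` (`(u,z) = 1`, i.e. `div(u) = 1`), `a ⊥ u`, is an admissible word, for `B` even (`exists_uGens_eichlerTransvection_eq`;
  the tree's `isWordIn_eichlerTransvection_of_dual` is the same proof read in Kirby's generators); and the kernel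
  sentence of §3.1: `t(y,a) = id ⟺ a ∈ ℤy` for `a ⊥ y` (`eichlerTransvection_eq_id_iff_exists_eq_smul`; the
  homomorphism `t(y,a) t(y,b) = t(y,a+b)` is the tree's `eichlerTransvection_comp`).
-/

noncomputable section

open Module
open LinearMap (BilinForm)
open LinearMap.BilinForm (IsometryEquiv)

namespace LinearMap.BilinForm

/-! ### §1a (t5): rescaling the isotropic vector -/

section Scaling

variable {R : Type*} [CommRing R] {M : Type*} [AddCommGroup M] [Module R M] (B : BilinForm R M)

/-- **(t5) `t(xe, a) = t(e, xa)`**, with the tree's extra parameter (`q` plays `½(a,a)`, so it rescales by `c²`):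
`E(c e, a, q) = E(e, c a, c² q)`. [cite: GritsenkoHulekSankaran2009, §3.1 (t5)] -/
theorem eichlerTransvection_smul_left (e a : M) (c q : R) :
    B.eichlerTransvection (c • e) a q = B.eichlerTransvection e (c • a) (c * c * q) := by
  ext v
  simp only [eichlerTransvection_apply, map_smul, LinearMap.smul_apply, smul_eq_mul, smul_smul]
  module

end Scaling

end LinearMap.BilinForm

namespace Literature.Topology.FourManifolds

/-! ### §1b The reflection `σ_w`, `w = x + ε y`, and conjugation of admissible words by it -/

section Swap

variable {W : Type*} [AddCommGroup W] {B : BilinForm ℤ W} {x y : W}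

/-- `(x + ε y, x + ε y) = 2ε` for a hyperbolic pair `x, y` (for `ε = −1` this is GHS's `(−2)`-vector `e − f`).
[cite: GritsenkoHulekSankaran2009, Prop. 3.3 (iv)] -/
theorem apply_add_smul_self (hB : B.IsSymm) (hxx : B x x = 0) (hyy : B y y = 0) (hxy : B x y = 1) (ε : ℤ) :
    B (x + ε • y) (x + ε • y) = ε + ε := by
  have hyx : B y x = 1 := by rw [hB.eq, hxy]
  simp only [map_add, map_smul, LinearMap.add_apply, LinearMap.smul_apply, smul_eq_mul, hxx, hyy, hxy, hyx]
  ring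

/-- `σ_w x = −ε y` (`w = x + ε y`, `ε² = 1`): `σ_{e−f}` swaps `e` and `f`. [cite: GritsenkoHulekSankaran2009, Prop. 3.3 (iv) (proof)] -/
theorem normTwoReflection_add_smul_apply_left (hB : B.IsSymm) (hxx : B x x = 0) (hxy : B x y = 1) {ε : ℤ}
    (hε : ε * ε = 1) : B.normTwoReflection (x + ε • y) ε x = -(ε • y) := by
  have hyx : B y x = 1 := by rw [hB.eq, hxy]
  rw [LinearMap.BilinForm.normTwoReflection_apply, map_add, map_smul, LinearMap.add_apply, LinearMap.smul_apply,
    smul_eq_mul, hxx, hyx, zero_add, mul_one, hε, one_smul]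
  abel

/-- `σ_w y = −ε x` (`w = x + ε y`, `ε² = 1`). [cite: GritsenkoHulekSankaran2009, Prop. 3.3 (iv) (proof)] -/
theorem normTwoReflection_add_smul_apply_right (hyy : B y y = 0) (hxy : B x y = 1) {ε : ℤ} (hε : ε * ε = 1) :
    B.normTwoReflection (x + ε • y) ε y = -(ε • x) := by
  rw [LinearMap.BilinForm.normTwoReflection_apply, map_add, map_smul, LinearMap.add_apply, LinearMap.smul_apply,
    smul_eq_mul, hyy, hxy, mul_zero, add_zero, mul_one, smul_add, smul_smul, hε, one_smul]
  abel

/-- `σ_w` fixes `U^⊥` pointwise (`w = x + ε y ∈ U`). [cite: GritsenkoHulekSankaran2009, Prop. 3.3 (iv) (proof)] -/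
theorem normTwoReflection_add_smul_apply_of_ortho {a : W} (hxa : B x a = 0) (hya : B y a = 0) (ε : ℤ) :
    B.normTwoReflection (x + ε • y) ε a = a := by
  rw [LinearMap.BilinForm.normTwoReflection_apply, map_add, map_smul, LinearMap.add_apply, LinearMap.smul_apply,
    smul_eq_mul, hxa, hya, mul_zero, add_zero, mul_zero, zero_smul, sub_zero]

/-- `σ_w` is an involution (`w = x + ε y`, `ε² = 1`). [cite: GritsenkoHulekSankaran2009, Prop. 3.3 (iv) (proof)] -/
theorem normTwoReflection_add_smul_normTwoReflection_add_smul (hB : B.IsSymm) (hxx : B x x = 0) (hyy : B y y = 0)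
    (hxy : B x y = 1) {ε : ℤ} (hε : ε * ε = 1) (v : W) :
    B.normTwoReflection (x + ε • y) ε (B.normTwoReflection (x + ε • y) ε v) = v :=
  Module.involutive_preReflection
    (LinearMap.BilinForm.smul_apply_self_eq_two (apply_add_smul_self hB hxx hyy hxy ε) hε) v

/-- **`σ_w t(y,a) σ_w = t(x, −εa)`, `σ_w t(x,a) σ_w = t(y, −εa)`**: the `σ_w`-conjugate of an admissible generator is
an admissible generator (by (t4) `γ t(e,a) γ⁻¹ = t(γe, γa)` and (t5)) — "`σ_{e−f} τ σ_{e−f} ∈ E_U(L₁)` for any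
`τ ∈ E_U(L₁)`", one letter. [cite: GritsenkoHulekSankaran2009, Prop. 3.3 (iv) (proof) and §3.1 (t4), (t5)] -/
theorem UGen.exists_conj_normTwoReflection (hB : B.IsSymm) (hxx : B x x = 0) (hyy : B y y = 0) (hxy : B x y = 1)
    {ε : ℤ} (hε : ε * ε = 1) {g : UGen W} (hg : g.IsAdmissible B x y) :
    ∃ g' : UGen W, g'.IsAdmissible B x y ∧ ∀ v,
      B.normTwoReflection (x + ε • y) ε (g.toLinearMap B x y (B.normTwoReflection (x + ε • y) ε v)) =
        g'.toLinearMap B x y v := by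
  have hw := apply_add_smul_self hB hxx hyy hxy ε
  set σ := LinearMap.BilinForm.normTwoReflectionEquiv hB (x + ε • y) ε hw hε with hσ
  have hσv : ∀ u, σ u = B.normTwoReflection (x + ε • y) ε u := fun u ↦ by
    rw [hσ, LinearMap.BilinForm.normTwoReflectionEquiv_apply, LinearMap.BilinForm.normTwoReflection_apply]
  have hσσ : ∀ u, σ (σ u) = u := fun u ↦ by
    rw [hσv, hσv]
    exact normTwoReflection_add_smul_normTwoReflection_add_smul hB hxx hyy hxy hε u
  have hσx : σ x = (-ε) • y := by rw [hσv, normTwoReflection_add_smul_apply_left hB hxx hxy hε, neg_smul]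
  have hσy : σ y = (-ε) • x := by rw [hσv, normTwoReflection_add_smul_apply_right hyy hxy hε, neg_smul]
  have hεε : -ε * -ε = 1 := by rw [neg_mul_neg, hε]
  cases g with
  | atY a q =>
    obtain ⟨hxa, hya, hq⟩ := hg
    have hσa : σ a = a := by rw [hσv, normTwoReflection_add_smul_apply_of_ortho hxa hya]
    refine ⟨UGen.atX ((-ε) • a) q, ⟨?_, ?_, ?_⟩, fun v ↦ ?_⟩
    · rw [map_smul, hxa, smul_zero]
    · rw [map_smul, hya, smul_zero]
    · rw [map_smul, map_smul, LinearMap.smul_apply, smul_eq_mul, smul_eq_mul, hq, ← mul_assoc, hεε, one_mul]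
    · rw [← hσv, ← hσv]
      change σ (B.eichlerTransvection y a q (σ v)) = B.eichlerTransvection x ((-ε) • a) q v
      rw [LinearMap.BilinForm.IsometryEquiv.map_eichlerTransvection_apply, hσy, hσa, hσσ,
        LinearMap.BilinForm.eichlerTransvection_smul_left, hεε, one_mul]
  | atX a q =>
    obtain ⟨hxa, hya, hq⟩ := hg
    have hσa : σ a = a := by rw [hσv, normTwoReflection_add_smul_apply_of_ortho hxa hya]
    refine ⟨UGen.atY ((-ε) • a) q, ⟨?_, ?_, ?_⟩, fun v ↦ ?_⟩
    · rw [map_smul, hxa, smul_zero]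
    · rw [map_smul, hya, smul_zero]
    · rw [map_smul, map_smul, LinearMap.smul_apply, smul_eq_mul, smul_eq_mul, hq, ← mul_assoc, hεε, one_mul]
    · rw [← hσv, ← hσv]
      change σ (B.eichlerTransvection x a q (σ v)) = B.eichlerTransvection y ((-ε) • a) q v
      rw [LinearMap.BilinForm.IsometryEquiv.map_eichlerTransvection_apply, hσx, hσa, hσσ,
        LinearMap.BilinForm.eichlerTransvection_smul_left, hεε, one_mul]

/-- **"`σ_{e−f} τ σ_{e−f} ∈ E_U(L₁)` for any `τ ∈ E_U(L₁)`"**: the `σ_w`-conjugate of an admissible word is an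
admissible word (letter by letter). [cite: GritsenkoHulekSankaran2009, Prop. 3.3 (iv) (proof)] -/
theorem UGen.exists_eval_conj_normTwoReflection (hB : B.IsSymm) (hxx : B x x = 0) (hyy : B y y = 0)
    (hxy : B x y = 1) {ε : ℤ} (hε : ε * ε = 1) (l : List (UGen W)) (hl : ∀ g ∈ l, g.IsAdmissible B x y) :
    ∃ l' : List (UGen W), (∀ g ∈ l', g.IsAdmissible B x y) ∧ ∀ v,
      B.normTwoReflection (x + ε • y) ε (UGen.eval B x y l (B.normTwoReflection (x + ε • y) ε v)) =
        UGen.eval B x y l' v := by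
  have hσσ := normTwoReflection_add_smul_normTwoReflection_add_smul hB hxx hyy hxy hε
  induction l with
  | nil =>
    refine ⟨[], fun g hg ↦ (List.not_mem_nil hg).elim, fun v ↦ ?_⟩
    rw [UGen.eval_nil, LinearMap.id_apply, LinearMap.id_apply, hσσ]
  | cons g l ih =>
    obtain ⟨l', hl', hll'⟩ := ih fun g' hg' ↦ hl g' (List.mem_cons_of_mem g hg')
    obtain ⟨g', hg', hgg'⟩ := UGen.exists_conj_normTwoReflection hB hxx hyy hxy hε (hl g List.mem_cons_self)
    refine ⟨g' :: l', fun k hk ↦ ?_, fun v ↦ ?_⟩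
    · rcases List.mem_cons.1 hk with rfl | hk
      · exact hg'
      · exact hl' k hk
    · rw [UGen.eval_cons, UGen.eval_cons, LinearMap.comp_apply, LinearMap.comp_apply, ← hll' v, ← hgg', hσσ]

/-- **"`t(e,∗) : e^⊥_L → S̃O⁺(L)` is a homomorphism of groups with kernel `ℤe`"** — the kernel: for `a ⊥ y` (with
`(a,a) = 2q`, `y` isotropic with `(x,y) = 1`), `t(y,a) = id ⟺ a ∈ ℤy` (evaluate at `x`; conversely `t(e, xe) = id`,
(t5)). The homomorphism `t(y,a) t(y,b) = t(y, a+b)` is the tree's `eichlerTransvection_comp`.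
[cite: GritsenkoHulekSankaran2009, §3.1 (after (8)) and (t5)] -/
theorem eichlerTransvection_eq_id_iff_exists_eq_smul (hB : B.IsSymm) (hyy : B y y = 0) (hxy : B x y = 1) {a : W}
    {q : ℤ} (haa : B a a = q + q) :
    B.eichlerTransvection y a q = LinearMap.id ↔ ∃ c : ℤ, a = c • y := by
  have hyx : B y x = 1 := by rw [hB.eq, hxy]
  constructor
  · intro hid
    have hx := LinearMap.congr_fun hid x
    rw [LinearMap.BilinForm.eichlerTransvection_apply, LinearMap.id_apply, hyx, one_smul, mul_one] at hx
    refine ⟨B a x + q, ?_⟩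
    rw [add_smul]
    calc a = (x + a - B a x • y - q • y) - x + B a x • y + q • y := by abel
      _ = x - x + B a x • y + q • y := by rw [hx]
      _ = B a x • y + q • y := by abel
  · rintro ⟨c, rfl⟩
    have hq : q = 0 := by
      rw [map_smul, map_smul, LinearMap.smul_apply, smul_eq_mul, smul_eq_mul, hyy, mul_zero, mul_zero] at haa
      omega
    subst hq
    ext v
    rw [LinearMap.BilinForm.eichlerTransvection_apply, LinearMap.id_apply, map_smul, LinearMap.smul_apply, smul_eq_mul,
      zero_mul, zero_smul, sub_zero, smul_smul, mul_comm, add_sub_cancel_right]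

end Swap

/-! ### §2 Prop. 3.3 (iv): `σ_r = ρ · σ_{e−f}` with `ρ ∈ E_U(L₁)` -/

section Reflections

variable {W : Type*} [AddCommGroup W] {B : BilinForm ℤ W} {x y x₁ y₁ : W} (h : TwoHyperbolicPairs B x y x₁ y₁)
include h

/-- **Prop. 3.3 (iv), exact form: `σ_r = ρ · σ_w` with `ρ ∈ E_U(L₁)`** — for a symmetric integral bilinear module
with two orthogonal hyperbolic pairs `(x, y)`, `(x₁, y₁)` and ANY vector `r` of norm `2ε` (`ε = ±1`; `w = x + ε y`, for
`ε = −1` GHS's `σ_{e−f}`), the reflection `σ_r` is an admissible word in the transvections `t(y,a)`, `t(x,a)`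
(`a ⊥ x, y`) composed with `σ_w`. Proof as printed: `τ r = a ⊥ U` (Lemma 3.2), (t7) `σ_a = t(y,a) t(x,εa) t(y,a) σ_w`,
`σ_r = τ⁻¹ σ_a τ`, and `σ_w τ σ_w ∈ E_U(L₁)`; the word is `τ⁻¹ · t(y,a) t(x,εa) t(y,a) · (σ_w τ σ_w)`.
[cite: GritsenkoHulekSankaran2009, Prop. 3.3 (iv)] -/
theorem exists_uGens_normTwoReflection_eq {r : W} {ε : ℤ} (hε : ε * ε = 1) (hr : B r r = ε + ε) :
    ∃ l : List (UGen W), (∀ g ∈ l, g.IsAdmissible B x y) ∧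
      ∀ v, B.normTwoReflection r ε v = UGen.eval B x y l (B.normTwoReflection (x + ε • y) ε v) := by
  have hB := h.isSymm
  have hσσ := normTwoReflection_add_smul_normTwoReflection_add_smul hB h.xx h.yy h.xy hε
  -- (1) `τ r = a ∈ U^⊥`
  obtain ⟨l₀, hl₀, hxa, hya⟩ := exists_uGens_ortho h r
  set a := UGen.eval B x y l₀ r with ha
  have haa : B a a = ε + ε := by rw [ha, UGen.map_eval hB h.xx h.yy hl₀, hr]
  -- (2) (t7): the three transvections `T` with `T u = σ_a (σ_w u)`
  have hεa : (UGen.atX (ε • a) ε).IsAdmissible B x y := by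
    refine ⟨by rw [map_smul, hxa, smul_zero], by rw [map_smul, hya, smul_zero], ?_⟩
    rw [map_smul, map_smul, LinearMap.smul_apply, smul_eq_mul, smul_eq_mul, haa, ← mul_assoc, hε, one_mul]
  have hTadm : ∀ g ∈ [UGen.atY a ε, UGen.atX (ε • a) ε, UGen.atY a ε], g.IsAdmissible B x y := by
    intro g hg
    simp only [List.mem_cons, List.not_mem_nil, or_false] at hg
    rcases hg with rfl | rfl | rfl
    · exact ⟨hxa, hya, haa⟩
    · exact hεa
    · exact ⟨hxa, hya, haa⟩
  have hT : ∀ u, UGen.eval B x y [UGen.atY a ε, UGen.atX (ε • a) ε, UGen.atY a ε] u =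
      B.normTwoReflection a ε (B.normTwoReflection (x + ε • y) ε u) := fun u ↦ by
    rw [UGen.eval_cons, UGen.eval_cons, UGen.eval_cons, UGen.eval_nil, LinearMap.comp_id, LinearMap.comp_apply,
      LinearMap.comp_apply]
    exact LinearMap.BilinForm.eichlerTransvection_t7 hB h.yy h.yx hya hxa haa hε u
  -- `τ σ_r = σ_a τ`
  have h1 : ∀ v, UGen.eval B x y l₀ (B.normTwoReflection r ε v) = B.normTwoReflection a ε (UGen.eval B x y l₀ v) := by
    intro v
    have key := LinearMap.BilinForm.map_normTwoReflection_apply (UGen.evalEquiv hB h.xx h.yy l₀ hl₀) r ε v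
    rw [UGen.evalEquiv_apply, UGen.evalEquiv_apply, UGen.evalEquiv_apply] at key
    rw [key]
  -- (3) `σ_w τ σ_w ∈ E_U(L₁)`
  obtain ⟨l₀', hl₀', hll₀'⟩ := UGen.exists_eval_conj_normTwoReflection hB h.xx h.yy h.xy hε l₀ hl₀
  refine ⟨UGen.invWord l₀ ++ ([UGen.atY a ε, UGen.atX (ε • a) ε, UGen.atY a ε] ++ l₀'), fun g hg ↦ ?_, fun v ↦ ?_⟩
  · simp only [List.mem_append] at hg
    rcases hg with hg | hg | hg
    · exact UGen.isAdmissible_of_mem_invWord hl₀ hg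
    · exact hTadm g hg
    · exact hl₀' g hg
  · rw [UGen.eval_append, LinearMap.comp_apply, UGen.eval_append, LinearMap.comp_apply, ← hll₀', hσσ, hT, hσσ, ← h1,
      UGen.eval_invWord_eval hB h.xx h.yy hl₀]

/-- The same with `σ_w` on the left: **`σ_r = σ_w · ρ'`**, `ρ' ∈ E_U(L₁)` (conjugate `ρ` by the involution `σ_w`).
[cite: GritsenkoHulekSankaran2009, Prop. 3.3 (iv)] -/
theorem exists_uGens_normTwoReflection_eq' {r : W} {ε : ℤ} (hε : ε * ε = 1) (hr : B r r = ε + ε) :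
    ∃ l : List (UGen W), (∀ g ∈ l, g.IsAdmissible B x y) ∧
      ∀ v, B.normTwoReflection r ε v = B.normTwoReflection (x + ε • y) ε (UGen.eval B x y l v) := by
  have hB := h.isSymm
  have hσσ := normTwoReflection_add_smul_normTwoReflection_add_smul hB h.xx h.yy h.xy hε
  obtain ⟨l, hl, hlr⟩ := exists_uGens_normTwoReflection_eq h hε hr
  obtain ⟨l', hl', hll'⟩ := UGen.exists_eval_conj_normTwoReflection hB h.xx h.yy h.xy hε l hl
  refine ⟨l', hl', fun v ↦ ?_⟩
  rw [← hll', hσσ, ← hlr]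

/-- **Prop. 3.3 (iv), bundled**: `σ_r = σ_w.trans ρ` as isometries (`ρ = UGen.evalEquiv l`, the tree's `trans`
applying `σ_w` first). [cite: GritsenkoHulekSankaran2009, Prop. 3.3 (iv)] -/
theorem exists_normTwoReflectionEquiv_eq_trans_evalEquiv {r : W} {ε : ℤ} (hε : ε * ε = 1) (hr : B r r = ε + ε) :
    ∃ (l : List (UGen W)) (hl : ∀ g ∈ l, g.IsAdmissible B x y),
      LinearMap.BilinForm.normTwoReflectionEquiv h.isSymm r ε hr hε =
        (LinearMap.BilinForm.normTwoReflectionEquiv h.isSymm (x + ε • y) ε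
            (apply_add_smul_self h.isSymm h.xx h.yy h.xy ε) hε).trans
          (UGen.evalEquiv h.isSymm h.xx h.yy l hl) := by
  obtain ⟨l, hl, hlr⟩ := exists_uGens_normTwoReflection_eq h hε hr
  refine ⟨l, hl, DFunLike.ext _ _ fun v ↦ ?_⟩
  rw [LinearMap.BilinForm.IsometryEquiv.trans_apply, UGen.evalEquiv_apply,
    LinearMap.BilinForm.normTwoReflectionEquiv_apply, LinearMap.BilinForm.normTwoReflectionEquiv_apply,
    ← LinearMap.BilinForm.normTwoReflection_apply, ← LinearMap.BilinForm.normTwoReflection_apply, hlr]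

/-! ### §3 "the product `σ_a σ_b` of any two reflections with `(a,a) = (b,b) = −2` belongs to `E(L)`" -/

/-- **`σ_a σ_b ∈ E_U(L₁)`** for any two vectors of the same norm `2ε` (`ε = ±1`): `σ_a σ_b = ρ_a σ_w σ_w ρ_b' = ρ_a ρ_b'`
— the first step of the proof of Prop. 3.4 (printed for `(a,a) = (b,b) = −2`; `E_U(L₁) ⊆ E(L)`).
[cite: GritsenkoHulekSankaran2009, Prop. 3.4 (proof, first sentence) and Prop. 3.3 (iv)] -/
theorem exists_uGens_normTwoReflection_normTwoReflection_eq {a b : W} {ε : ℤ} (hε : ε * ε = 1)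
    (ha : B a a = ε + ε) (hb : B b b = ε + ε) :
    ∃ l : List (UGen W), (∀ g ∈ l, g.IsAdmissible B x y) ∧
      ∀ v, B.normTwoReflection a ε (B.normTwoReflection b ε v) = UGen.eval B x y l v := by
  have hσσ := normTwoReflection_add_smul_normTwoReflection_add_smul h.isSymm h.xx h.yy h.xy hε
  obtain ⟨la, hla, hlar⟩ := exists_uGens_normTwoReflection_eq h hε ha
  obtain ⟨lb, hlb, hlbr⟩ := exists_uGens_normTwoReflection_eq' h hε hb
  refine ⟨la ++ lb, fun g hg ↦ ?_, fun v ↦ ?_⟩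
  · rcases List.mem_append.1 hg with hg | hg
    exacts [hla g hg, hlb g hg]
  · rw [hlbr, hlar, hσσ, UGen.eval_append, LinearMap.comp_apply]

/-- Words of `(2ε)`-reflections (one sign `ε = ±1`): **a word of even length is an admissible word, a word of odd
length is `ρ ∘ σ_w` with `ρ` an admissible word** — the two cosets of `E_U(L₁)` in `⟨E_U(L₁), σ_r's⟩`.
[cite: GritsenkoHulekSankaran2009, Prop. 3.4 (proof, first sentence) and Prop. 3.3 (iv)] -/
theorem exists_uGens_wordProd_eq {ε : ℤ} (hε : ε * ε = 1) (L : List (B.IsometryEquiv B))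
    (hL : ∀ s ∈ L, ∃ (r : W) (hr : B r r = ε + ε), s = LinearMap.BilinForm.normTwoReflectionEquiv h.isSymm r ε hr hε) :
    (Even L.length → ∃ l : List (UGen W), (∀ g ∈ l, g.IsAdmissible B x y) ∧
      ∀ v, wordProd L v = UGen.eval B x y l v) ∧
    (Odd L.length → ∃ l : List (UGen W), (∀ g ∈ l, g.IsAdmissible B x y) ∧
      ∀ v, wordProd L v = UGen.eval B x y l (B.normTwoReflection (x + ε • y) ε v)) := by
  have hσσ := normTwoReflection_add_smul_normTwoReflection_add_smul h.isSymm h.xx h.yy h.xy hε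
  induction L with
  | nil =>
    exact ⟨fun _ ↦ ⟨[], fun g hg ↦ (List.not_mem_nil hg).elim, fun v ↦ rfl⟩, fun hodd ↦ (Nat.not_odd_zero hodd).elim⟩
  | cons s L ih =>
    obtain ⟨ih₁, ih₂⟩ := ih fun s' hs' ↦ hL s' (List.mem_cons_of_mem s hs')
    obtain ⟨r, hr, rfl⟩ := hL s List.mem_cons_self
    have hsv : ∀ v, LinearMap.BilinForm.normTwoReflectionEquiv h.isSymm r ε hr hε v = B.normTwoReflection r ε v :=
      fun v ↦ by rw [LinearMap.BilinForm.normTwoReflectionEquiv_apply, LinearMap.BilinForm.normTwoReflection_apply]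
    refine ⟨fun heven ↦ ?_, fun hodd ↦ ?_⟩
    · -- `L` has odd length: `wordProd L (σ_r v) = ρ (σ_w (σ_r v)) = ρ (σ_w (σ_w (ρ_r v)))`
      rw [List.length_cons, Nat.even_add_one, Nat.not_even_iff_odd] at heven
      obtain ⟨l, hl, hlv⟩ := ih₂ heven
      obtain ⟨lr, hlr, hlrv⟩ := exists_uGens_normTwoReflection_eq' h hε hr
      refine ⟨l ++ lr, fun g hg ↦ ?_, fun v ↦ ?_⟩
      · rcases List.mem_append.1 hg with hg | hg
        exacts [hl g hg, hlr g hg]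
      · rw [wordProd_cons, LinearMap.BilinForm.IsometryEquiv.trans_apply, hlv, hsv, hlrv, hσσ, UGen.eval_append,
          LinearMap.comp_apply]
    · -- `L` has even length: `wordProd L (σ_r v) = ρ (σ_r v) = ρ (ρ_r (σ_w v))`
      rw [List.length_cons, Nat.odd_add_one, Nat.not_odd_iff_even] at hodd
      obtain ⟨l, hl, hlv⟩ := ih₁ hodd
      obtain ⟨lr, hlr, hlrv⟩ := exists_uGens_normTwoReflection_eq h hε hr
      refine ⟨l ++ lr, fun g hg ↦ ?_, fun v ↦ ?_⟩
      · rcases List.mem_append.1 hg with hg | hg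
        exacts [hl g hg, hlr g hg]
      · rw [wordProd_cons, LinearMap.BilinForm.IsometryEquiv.trans_apply, hlv, hsv, hlrv, UGen.eval_append,
          LinearMap.comp_apply]

/-- **Even words of `(2ε)`-reflections lie in `E_U(L₁)`** (in particular `σ_a σ_b`, the printed case).
[cite: GritsenkoHulekSankaran2009, Prop. 3.4 (proof, first sentence)] -/
theorem exists_uGens_wordProd_eq_of_even {ε : ℤ} (hε : ε * ε = 1) (L : List (B.IsometryEquiv B))
    (hL : ∀ s ∈ L, ∃ (r : W) (hr : B r r = ε + ε), s = LinearMap.BilinForm.normTwoReflectionEquiv h.isSymm r ε hr hε)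
    (heven : Even L.length) :
    ∃ l : List (UGen W), (∀ g ∈ l, g.IsAdmissible B x y) ∧ ∀ v, wordProd L v = UGen.eval B x y l v :=
  (exists_uGens_wordProd_eq h hε L hL).1 heven

/-- **Odd words of `(2ε)`-reflections lie in `E_U(L₁) · σ_w`.** [cite: GritsenkoHulekSankaran2009, Prop. 3.3 (iv)] -/
theorem exists_uGens_wordProd_eq_of_odd {ε : ℤ} (hε : ε * ε = 1) (L : List (B.IsometryEquiv B))
    (hL : ∀ s ∈ L, ∃ (r : W) (hr : B r r = ε + ε), s = LinearMap.BilinForm.normTwoReflectionEquiv h.isSymm r ε hr hε)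
    (hodd : Odd L.length) :
    ∃ l : List (UGen W), (∀ g ∈ l, g.IsAdmissible B x y) ∧
      ∀ v, wordProd L v = UGen.eval B x y l (B.normTwoReflection (x + ε • y) ε v) :=
  (exists_uGens_wordProd_eq h hε L hL).2 hodd

/-! ### §4 Prop. 3.3 (ii): `E(L) = E_U(L₁)` -/

/-- **Prop. 3.3 (ii) `E(L) = E_U(L₁)`, the non-trivial inclusion for generators**: in a symmetric EVEN integral
bilinear module with two orthogonal hyperbolic pairs, every transvection `t(u,a)` (`(u,u) = (u,a) = 0`, `(a,a) = 2q`)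
at an isotropic `u` having a dual vector `z` (`(u,z) = 1`, i.e. `div(u) = 1`, "unimodular") is an admissible word in
`t(y,·)`, `t(x,·)`. Proof as printed: `τ u = y` for some `τ ∈ E_U(L₁)` (the Eichler criterion,
`exists_uGens_apply_eq`), and `τ t(u,a) τ⁻¹ = t(τu, τa) = t(y, τa) = t(y, τa − (x,τa) y)` is an admissible generator.
[cite: GritsenkoHulekSankaran2009, Prop. 3.3 (ii)] -/
theorem exists_uGens_eichlerTransvection_eq (hev : B.IsEven) {u z a : W} {q : ℤ} (hu : B u u = 0) (huz : B u z = 1)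
    (hua : B u a = 0) (ha : B a a = q + q) :
    ∃ l : List (UGen W), (∀ g ∈ l, g.IsAdmissible B x y) ∧
      ∀ v, B.eichlerTransvection u a q v = UGen.eval B x y l v := by
  have hB := h.isSymm
  -- the Eichler criterion: `τ u = y`
  obtain ⟨l₀, hl₀, hl₀u⟩ := exists_uGens_apply_eq h hev hu huz
  have hya : B y (UGen.eval B x y l₀ a) = 0 := by
    have key := UGen.map_eval hB h.xx h.yy hl₀ u a
    rwa [hl₀u, hua] at key
  have hay : B (UGen.eval B x y l₀ a) y = 0 := by rw [hB.eq, hya]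
  have haa : B (UGen.eval B x y l₀ a) (UGen.eval B x y l₀ a) = q + q := by rw [UGen.map_eval hB h.xx h.yy hl₀, ha]
  -- the admissible letter `t(y, b)`, `b = τa − (x, τa) y`
  set c : ℤ := B x (UGen.eval B x y l₀ a) with hc
  set b : W := UGen.eval B x y l₀ a - c • y with hb
  have hxb : B x b = 0 := by rw [hb, map_sub, map_smul, ← hc, h.xy, smul_eq_mul, mul_one, sub_self]
  have hyb : B y b = 0 := by rw [hb, map_sub, map_smul, hya, h.yy, smul_zero, sub_zero]
  have hbb : B b b = q + q := by
    simp only [hb, map_sub, map_smul, LinearMap.sub_apply, LinearMap.smul_apply, smul_eq_mul, hya, hay, h.yy, haa]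
    ring
  -- `τ t(u,a) = t(y,b) τ`
  have key : ∀ v, UGen.eval B x y l₀ (B.eichlerTransvection u a q v) =
      B.eichlerTransvection y b q (UGen.eval B x y l₀ v) := fun v ↦ by
    have nat := LinearMap.BilinForm.IsometryEquiv.map_eichlerTransvection_apply (UGen.evalEquiv hB h.xx h.yy l₀ hl₀) u a q v
    rw [UGen.evalEquiv_apply, UGen.evalEquiv_apply, UGen.evalEquiv_apply, UGen.evalEquiv_apply, hl₀u] at nat
    rw [nat, hb, LinearMap.BilinForm.eichlerTransvection_sub_smul]
  refine ⟨UGen.invWord l₀ ++ (UGen.atY b q :: l₀), fun g hg ↦ ?_, fun v ↦ ?_⟩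
  · rcases List.mem_append.1 hg with hg | hg
    · exact UGen.isAdmissible_of_mem_invWord hl₀ hg
    · rcases List.mem_cons.1 hg with rfl | hg
      · exact ⟨hxb, hyb, hbb⟩
      · exact hl₀ g hg
  · rw [UGen.eval_append, LinearMap.comp_apply, UGen.eval_cons, LinearMap.comp_apply]
    change _ = UGen.eval B x y (UGen.invWord l₀) (B.eichlerTransvection y b q (UGen.eval B x y l₀ v))
    rw [← key, UGen.eval_invWord_eval hB h.xx h.yy hl₀]

end Reflections

end Literature.Topology.FourManifolds

end
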